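import Literature.MathematicalPhysics.KineticTheory.LangevinChainKernelDensity
import Literature.MathematicalPhysics.KineticTheory.LangevinChainEnergyIdentity

/-!
# Energy window, part S′a — Grönwall with a continuous coefficient; the drift derivative vs. √H

Lineage `stmt-AtomisticToContinuum-9121` (`ExtensiveSnapshotIrreversibility`), K_fix half, leaf S3
`KernelTemperatureLipschitz`; support leaf **(JM) `FlowJacobianMoment`** of part R
(`…EnergyWindowSkeletonWeights`).  (JM) is proved in three files: S′a (this file: the two
deterministic ingredients), S′p (`…EnergyWindowFlowJacobianPathwise`: the pathwise bound on the
momentum-direction Jacobian of the flow) and S′b (`…EnergyWindowFlowJacobianMoment`: moments, proves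
`FlowJacobianMoment` by name).  This file imports only the Literature Langevin-chain stack
(it can land at any time).

What is proved here (all complete, no placeholders):

* §1 `norm_le_mul_exp_integral_of_eq_add_integral` — Grönwall for a linear integral equation
  `w(t) = w₀ + ∫₀ᵗ A(s) w(s) ds` with a CONTINUOUS, time-dependent operator bound
  `‖A(s) v‖ ≤ a(s) ‖v‖`: `‖w(t)‖ ≤ ‖w₀‖ exp(∫₀ᵗ a)` (the tree / Mathlib versions take a
  constant bound; the variable coefficient is what lets the energy enter only through
  `∫₀ˢ √H(X_u) du`).
* §2 `norm_fderiv_drift_apply_le` — the operator norm (sup-norm on phase space) of the drift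
  derivative of the pinned anharmonic chain grows at most like the square root of the energy:
  `‖DY(x) v‖ ≤ (A₀ + A₁ √H(x)) ‖v‖` with the explicit constants `driftA₀`, `driftA₁`
  (`|U''(q)| = ω₂ + 3 lam q² ≤ ω₂ + 6 √lam √H`, `|V''(r)| = 1 + 3 β r² ≤ 1 + 6 √β √H` on
  bonds, from `lam q⁴/4 ≤ H`, `β r⁴/4 ≤ H`).

[cite: CuneoEckmannHairerReyBellet2018, §3 eq. (3.4)] (the energy `H` these bounds feed into;
the Grönwall and drift-derivative estimates themselves are classical). [folklore]
-/

noncomputable section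

namespace Summit.AtomisticToContinuum.FouriersLaw.Theorems.ExtensiveSnapshotIrreversibility.EnergyWindow

open MeasureTheory Filter Topology Real unitInterval Set
open scoped ENNReal NNReal ContDiff
open Literature.MathematicalPhysics.KineticTheory.HeatConduction
open Literature.Probability.Process Literature.Analysis.ODE

/-! ## 1. Grönwall for a linear integral equation with a continuous coefficient -/

/-- **Grönwall, linear integral equation, variable coefficient.** If `w` is continuous,
`w(t) = w₀ + ∫₀ᵗ A(s) (w s) ds` on `[0, T]` and `‖A(s) v‖ ≤ a(s) ‖v‖` with `a ≥ 0` continuous, then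
`‖w(t)‖ ≤ ‖w₀‖ · exp(∫₀ᵗ a)` on `[0, T]`.  Proof: `R(t) = ‖w₀‖ + ∫₀ᵗ a ‖w‖` dominates `‖w‖` and
`R e^{-∫a}` is non-increasing. [folklore] -/
theorem norm_le_mul_exp_integral_of_eq_add_integral {E : Type*} [NormedAddCommGroup E]
    [NormedSpace ℝ E] [CompleteSpace E] {w : ℝ → E} {A : ℝ → E →L[ℝ] E} {a : ℝ → ℝ} {w₀ : E}
    {T : ℝ} (hw : Continuous w) (hA : Continuous A) (ha : Continuous a)
    (hAa : ∀ t v, ‖A t v‖ ≤ a t * ‖v‖) (ha0 : ∀ t, 0 ≤ a t)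
    (heq : ∀ t ∈ Icc (0 : ℝ) T, w t = w₀ + ∫ s in (0 : ℝ)..t, A s (w s)) {t : ℝ}
    (ht : t ∈ Icc (0 : ℝ) T) :
    ‖w t‖ ≤ ‖w₀‖ * Real.exp (∫ s in (0 : ℝ)..t, a s) := by
  -- the majorant `R` and the integrated rate `B`
  have hgc : Continuous fun s => a s * ‖w s‖ := ha.mul hw.norm
  have hwR : ∀ u ∈ Icc (0 : ℝ) T, ‖w u‖ ≤ ‖w₀‖ + ∫ s in (0 : ℝ)..u, a s * ‖w s‖ := by
    intro u hu
    rw [heq u hu]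
    refine (norm_add_le _ _).trans ?_
    gcongr
    refine (intervalIntegral.norm_integral_le_integral_norm hu.1).trans ?_
    exact intervalIntegral.integral_mono_on hu.1 ((hA.clm_apply hw).norm.intervalIntegrable _ _)
      (hgc.intervalIntegrable _ _) fun s _ => hAa s (w s)
  have hRd : ∀ u, HasDerivAt (fun u => ‖w₀‖ + ∫ s in (0 : ℝ)..u, a s * ‖w s‖) (a u * ‖w u‖) u :=
    fun u => (intervalIntegral.integral_hasDerivAt_right (hgc.intervalIntegrable 0 u)
      (hgc.stronglyMeasurableAtFilter _ _) hgc.continuousAt).const_add _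
  have hBd : ∀ u, HasDerivAt (fun u => ∫ s in (0 : ℝ)..u, a s) (a u) u := fun u =>
    intervalIntegral.integral_hasDerivAt_right (ha.intervalIntegrable 0 u)
      (ha.stronglyMeasurableAtFilter _ _) ha.continuousAt
  -- `Φ = R · e^{-B}` is non-increasing on `[0, T]`
  set Φ : ℝ → ℝ := fun u =>
    (‖w₀‖ + ∫ s in (0 : ℝ)..u, a s * ‖w s‖) * Real.exp (-∫ s in (0 : ℝ)..u, a s) with hΦ
  have hΦd : ∀ u, HasDerivAt Φ (a u * ‖w u‖ * Real.exp (-∫ s in (0 : ℝ)..u, a s) +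
      (‖w₀‖ + ∫ s in (0 : ℝ)..u, a s * ‖w s‖) *
        (Real.exp (-∫ s in (0 : ℝ)..u, a s) * -a u)) u :=
    fun u => (hRd u).mul (hBd u).neg.exp
  have hanti : AntitoneOn Φ (Icc 0 T) := by
    refine antitoneOn_of_deriv_nonpos (convex_Icc 0 T)
      (fun u _ => (hΦd u).continuousAt.continuousWithinAt)
      (fun u _ => (hΦd u).differentiableAt.differentiableWithinAt) fun u hu => ?_
    rw [interior_Icc] at hu
    rw [(hΦd u).deriv]
    have h1 : a u * ‖w u‖ ≤ a u * (‖w₀‖ + ∫ s in (0 : ℝ)..u, a s * ‖w s‖) :=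
      mul_le_mul_of_nonneg_left (hwR u (Ioo_subset_Icc_self hu)) (ha0 u)
    have h2 : a u * ‖w u‖ * Real.exp (-∫ s in (0 : ℝ)..u, a s) +
        (‖w₀‖ + ∫ s in (0 : ℝ)..u, a s * ‖w s‖) * (Real.exp (-∫ s in (0 : ℝ)..u, a s) * -a u) =
        Real.exp (-∫ s in (0 : ℝ)..u, a s) *
          (a u * ‖w u‖ - a u * (‖w₀‖ + ∫ s in (0 : ℝ)..u, a s * ‖w s‖)) := by ring
    rw [h2]
    exact mul_nonpos_of_nonneg_of_nonpos (Real.exp_pos _).le (by linarith)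
  have h0T : (0 : ℝ) ∈ Icc 0 T := ⟨le_rfl, ht.1.trans ht.2⟩
  have hΦ0 : Φ 0 = ‖w₀‖ := by simp [hΦ]
  have hle : Φ t ≤ ‖w₀‖ := hΦ0 ▸ hanti h0T ht ht.1
  -- unwind
  have hexp : (‖w₀‖ + ∫ s in (0 : ℝ)..t, a s * ‖w s‖) ≤
      ‖w₀‖ * Real.exp (∫ s in (0 : ℝ)..t, a s) := by
    have h := mul_le_mul_of_nonneg_right hle (Real.exp_pos (∫ s in (0 : ℝ)..t, a s)).le
    have h' : Φ t * Real.exp (∫ s in (0 : ℝ)..t, a s) =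
        ‖w₀‖ + ∫ s in (0 : ℝ)..t, a s * ‖w s‖ := by
      simp only [hΦ]
      rw [mul_assoc, ← Real.exp_add, neg_add_cancel, Real.exp_zero, mul_one]
    linarith
  exact (hwR t ht).trans hexp

/-! ## 2. The drift derivative grows at most like `√H` -/

/-- `3 c t ≤ 6 √c √H` when `c, t ≥ 0` and `c t² / 4 ≤ H` (used with `t = q²`, `t = r²`).
[folklore] -/
theorem three_mul_mul_le_of_sq_le {c t H : ℝ} (hc : 0 ≤ c) (h : c * t ^ 2 / 4 ≤ H) :
    3 * c * t ≤ 6 * √c * √H := by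
  have h1 : √c * t ≤ 2 * √H := by
    have h2 : (√c * t) ^ 2 ≤ 4 * H := by
      rw [mul_pow, Real.sq_sqrt hc]; linarith
    calc √c * t ≤ √(4 * H) := Real.le_sqrt_of_sq_le h2
      _ = 2 * √H := by
          rw [Real.sqrt_mul (by norm_num : (0 : ℝ) ≤ 4), show √(4 : ℝ) = 2 by
            rw [show (4 : ℝ) = 2 ^ 2 by norm_num, Real.sqrt_sq (by norm_num)]]
  calc 3 * c * t = 3 * √c * (√c * t) := by
        rw [show 3 * √c * (√c * t) = 3 * (√c * √c) * t by ring, Real.mul_self_sqrt hc]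
    _ ≤ 3 * √c * (2 * √H) := mul_le_mul_of_nonneg_left h1 (by positivity)
    _ = 6 * √c * √H := by ring

/-- The constant part `A₀ = 1 + 2γ + N (ω₂ + N²)` of the drift-derivative bound. [folklore] -/
def driftA₀ (ω₂ γ : ℝ) (N : ℕ) : ℝ := 1 + 2 * γ + N * (ω₂ + N * N)

/-- The `√H` coefficient `A₁ = N (6 √lam + 6 N² √β)` of the drift-derivative bound. [folklore] -/
def driftA₁ (lam β : ℝ) (N : ℕ) : ℝ := N * (6 * √lam + N * N * (6 * √β))

/-- `1 ≤ A₀`. [folklore] -/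
theorem one_le_driftA₀ {ω₂ γ : ℝ} (hω : 0 ≤ ω₂) (hγ : 0 ≤ γ) (N : ℕ) : 1 ≤ driftA₀ ω₂ γ N := by
  unfold driftA₀; nlinarith [mul_nonneg (Nat.cast_nonneg N : (0 : ℝ) ≤ N)
    (add_nonneg hω (mul_nonneg (Nat.cast_nonneg N) (Nat.cast_nonneg N)))]

/-- `0 ≤ A₀`. [folklore] -/
theorem driftA₀_nonneg {ω₂ γ : ℝ} (hω : 0 ≤ ω₂) (hγ : 0 ≤ γ) (N : ℕ) : 0 ≤ driftA₀ ω₂ γ N :=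
  zero_le_one.trans (one_le_driftA₀ hω hγ N)

/-- `0 ≤ A₁`. [folklore] -/
theorem driftA₁_nonneg (lam β : ℝ) (N : ℕ) : 0 ≤ driftA₁ lam β N := by
  unfold driftA₁; positivity

section Drift

variable {ω₂ lam β γ : ℝ} (hω : 0 < ω₂) (hl : 0 ≤ lam) (hβ : 0 ≤ β) (hγ : 0 ≤ γ) (N : ℕ)

include hω hl hβ in
/-- Entrywise bound of the potential Hessian by the energy: `|Hess_{ij}(q)| ≤ (ω₂ + N²) +
(6√lam + 6 N² √β) √H(q, p)`. [folklore] -/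
theorem abs_hessPotential_le (x : PhaseSpace N) (i j : Fin N) :
    |(pinnedChain ω₂ lam β γ).hessPotential N i j x.1| ≤
      (ω₂ + (N : ℝ) * N) + (6 * √lam + (N : ℝ) * N * (6 * √β)) *
        √((pinnedChain ω₂ lam β γ).hamiltonian N x) := by
  set H := (pinnedChain ω₂ lam β γ).hamiltonian N x with hH
  have hH0 : 0 ≤ H := pinnedChain_hamiltonian_nonneg hω.le hl hβ γ N x
  -- second derivatives of the potentials
  have hU2 : ∀ a : ℝ, deriv (deriv (pinnedChain ω₂ lam β γ).U) a = ω₂ + 3 * lam * a ^ 2 := by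
    intro a
    have hd : deriv (pinnedChain ω₂ lam β γ).U = fun q => ω₂ * q + lam * q ^ 3 :=
      funext (pinnedChain_deriv_U ω₂ lam β γ)
    rw [hd]
    have h := (hasDerivAt_const_mul ω₂ : HasDerivAt (fun y : ℝ => ω₂ * y) ω₂ a).fun_add
      ((hasDerivAt_pow 3 a).const_mul lam)
    rw [h.deriv]
    norm_num; ring
  have hV2 : ∀ r : ℝ, deriv (deriv (pinnedChain ω₂ lam β γ).V) r = 1 + 3 * β * r ^ 2 :=
    fun r => pinnedChain_deriv_deriv_V ω₂ lam β γ r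
  have hind : ∀ (p q : Prop) [Decidable p] [Decidable q],
      |((if p then (1 : ℝ) else 0) - (if q then 1 else 0))| ≤ 1 := by
    intro p q _ _; split_ifs <;> norm_num
  -- pinning entry
  have h1 : |deriv (deriv (pinnedChain ω₂ lam β γ).U) (x.1 i) * (if i = j then 1 else 0)| ≤
      ω₂ + 6 * √lam * √H := by
    have hq : 3 * lam * x.1 i ^ 2 ≤ 6 * √lam * √H := by
      refine three_mul_mul_le_of_sq_le hl ?_
      have h := pinnedChain_U_le_hamiltonian hω.le hl hβ γ N x i
      have h4 : (x.1 i ^ 2) ^ 2 = x.1 i ^ 4 := by ring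
      rw [h4]; nlinarith [mul_nonneg hω.le (sq_nonneg (x.1 i))]
    have hnn : 0 ≤ deriv (deriv (pinnedChain ω₂ lam β γ).U) (x.1 i) := by
      rw [hU2]; positivity
    have hι : |(if i = j then (1 : ℝ) else 0)| ≤ 1 := by split_ifs <;> norm_num
    calc |deriv (deriv (pinnedChain ω₂ lam β γ).U) (x.1 i) * (if i = j then 1 else 0)|
        = deriv (deriv (pinnedChain ω₂ lam β γ).U) (x.1 i) * |(if i = j then (1 : ℝ) else 0)| := by
          rw [abs_mul, abs_of_nonneg hnn]
      _ ≤ deriv (deriv (pinnedChain ω₂ lam β γ).U) (x.1 i) * 1 :=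
          mul_le_mul_of_nonneg_left hι hnn
      _ ≤ ω₂ + 6 * √lam * √H := by rw [mul_one, hU2]; linarith
  -- bond entries
  have h2 : ∀ k l : Fin N,
      |(if l.val = k.val + 1 then
          deriv (deriv (pinnedChain ω₂ lam β γ).V) (x.1 l - x.1 k) *
            ((if l = j then 1 else 0) - (if k = j then 1 else 0)) *
            ((if l = i then 1 else 0) - (if k = i then 1 else 0)) else (0 : ℝ))| ≤
        1 + 6 * √β * √H := by
    intro k l
    have hc : (0 : ℝ) ≤ 1 + 6 * √β * √H := by positivity
    by_cases hlk : l.val = k.val + 1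
    · rw [if_pos hlk]
      have hr : 3 * β * (x.1 l - x.1 k) ^ 2 ≤ 6 * √β * √H := by
        refine three_mul_mul_le_of_sq_le hβ ?_
        have hb := pinnedChain_bond_le_hamiltonian hω.le hl hβ γ N x hlk
        have h4 : ((x.1 l - x.1 k) ^ 2) ^ 2 = (x.1 l - x.1 k) ^ 4 := by ring
        rw [h4]; nlinarith [sq_nonneg (x.1 l - x.1 k)]
      have hnn : 0 ≤ deriv (deriv (pinnedChain ω₂ lam β γ).V) (x.1 l - x.1 k) := by
        rw [hV2]; positivity
      have ha := hind (l = j) (k = j)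
      have hb := hind (l = i) (k = i)
      calc |deriv (deriv (pinnedChain ω₂ lam β γ).V) (x.1 l - x.1 k) *
              ((if l = j then 1 else 0) - (if k = j then 1 else 0)) *
              ((if l = i then 1 else 0) - (if k = i then 1 else 0))|
          = deriv (deriv (pinnedChain ω₂ lam β γ).V) (x.1 l - x.1 k) *
              |((if l = j then (1 : ℝ) else 0) - (if k = j then 1 else 0))| *
              |((if l = i then (1 : ℝ) else 0) - (if k = i then 1 else 0))| := by
            rw [abs_mul, abs_mul, abs_of_nonneg hnn]
        _ ≤ deriv (deriv (pinnedChain ω₂ lam β γ).V) (x.1 l - x.1 k) * 1 * 1 := by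
            gcongr
        _ ≤ 1 + 6 * √β * √H := by rw [mul_one, mul_one, hV2]; linarith
    · rw [if_neg hlk, abs_zero]; exact hc
  -- assemble
  unfold OscillatorChain.hessPotential
  refine (abs_add_le _ _).trans ?_
  have hsum : |∑ k : Fin N, ∑ l : Fin N,
      (if l.val = k.val + 1 then
          deriv (deriv (pinnedChain ω₂ lam β γ).V) (x.1 l - x.1 k) *
            ((if l = j then 1 else 0) - (if k = j then 1 else 0)) *
            ((if l = i then 1 else 0) - (if k = i then 1 else 0)) else (0 : ℝ))| ≤
      (N : ℝ) * ((N : ℝ) * (1 + 6 * √β * √H)) := by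
    refine (Finset.abs_sum_le_sum_abs _ _).trans ?_
    calc ∑ k : Fin N, |∑ l : Fin N, (if l.val = k.val + 1 then
            deriv (deriv (pinnedChain ω₂ lam β γ).V) (x.1 l - x.1 k) *
              ((if l = j then 1 else 0) - (if k = j then 1 else 0)) *
              ((if l = i then 1 else 0) - (if k = i then 1 else 0)) else (0 : ℝ))|
        ≤ ∑ k : Fin N, ∑ l : Fin N, (1 + 6 * √β * √H) :=
          Finset.sum_le_sum fun k _ =>
            (Finset.abs_sum_le_sum_abs _ _).trans (Finset.sum_le_sum fun l _ => h2 k l)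
      _ = (N : ℝ) * ((N : ℝ) * (1 + 6 * √β * √H)) := by
          simp only [Finset.sum_const, Finset.card_univ, Fintype.card_fin, nsmul_eq_mul]
  refine (add_le_add h1 hsum).trans (le_of_eq ?_)
  ring

include hω hl hβ hγ in
/-- **The drift derivative grows at most like `√H`** (sup-norm on phase space):
`‖DY(x) v‖ ≤ (A₀ + A₁ √H(x)) ‖v‖`. [folklore] -/
theorem norm_fderiv_drift_apply_le (x v : PhaseSpace N) :
    ‖fderiv ℝ ((pinnedChain ω₂ lam β γ).drift N) x v‖ ≤
      (driftA₀ ω₂ γ N + driftA₁ lam β N * √((pinnedChain ω₂ lam β γ).hamiltonian N x)) * ‖v‖ := by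
  set H := (pinnedChain ω₂ lam β γ).hamiltonian N x with hH
  set K := (ω₂ + (N : ℝ) * N) + (6 * √lam + (N : ℝ) * N * (6 * √β)) * √H with hK
  have hKij : ∀ i j, |(pinnedChain ω₂ lam β γ).hessPotential N i j x.1| ≤ K :=
    fun i j => abs_hessPotential_le hω hl hβ N x i j
  have hK0 : 0 ≤ K := by rw [hK]; positivity
  have hA : driftA₀ ω₂ γ N + driftA₁ lam β N * √H = 1 + ((N : ℝ) * K + 2 * γ) := by
    rw [driftA₀, driftA₁, hK]; ring
  have hv1 : ∀ j, |v.1 j| ≤ ‖v‖ := fun j => by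
    rw [← Real.norm_eq_abs]; exact (norm_le_pi_norm _ j).trans (norm_fst_le v)
  have hv2 : ∀ j, |v.2 j| ≤ ‖v‖ := fun j => by
    rw [← Real.norm_eq_abs]; exact (norm_le_pi_norm _ j).trans (norm_snd_le v)
  have hNK : 0 ≤ (N : ℝ) * K + 2 * γ := by positivity
  rw [(pinnedChain ω₂ lam β γ).fderiv_drift_apply (pinnedChain_contDiff_U ω₂ lam β γ)
    (pinnedChain_contDiff_V ω₂ lam β γ) N x v, Prod.norm_def]
  refine max_le ?_ ?_
  · calc ‖v.2‖ ≤ ‖v‖ := norm_snd_le v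
      _ = 1 * ‖v‖ := (one_mul _).symm
      _ ≤ (driftA₀ ω₂ γ N + driftA₁ lam β N * √H) * ‖v‖ := by
          refine mul_le_mul_of_nonneg_right ?_ (norm_nonneg _)
          rw [hA]; linarith
  · have hA0 : 0 ≤ (driftA₀ ω₂ γ N + driftA₁ lam β N * √H) * ‖v‖ := by
      rw [hA]; exact mul_nonneg (by positivity) (norm_nonneg _)
    refine (pi_norm_le_iff_of_nonneg hA0).2 fun i => ?_
    rw [Real.norm_eq_abs]
    have hPγ : (pinnedChain ω₂ lam β γ).γ = γ := rfl
    have hs : |∑ j, (pinnedChain ω₂ lam β γ).hessPotential N i j x.1 * v.1 j| ≤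
        (N : ℝ) * (K * ‖v‖) := by
      refine (Finset.abs_sum_le_sum_abs _ _).trans ?_
      calc ∑ j, |(pinnedChain ω₂ lam β γ).hessPotential N i j x.1 * v.1 j|
          ≤ ∑ _j : Fin N, K * ‖v‖ := Finset.sum_le_sum fun j _ => by
            rw [abs_mul]; exact mul_le_mul (hKij i j) (hv1 j) (abs_nonneg _) hK0
        _ = (N : ℝ) * (K * ‖v‖) := by
            simp only [Finset.sum_const, Finset.card_univ, Fintype.card_fin, nsmul_eq_mul]
    have hb : |(pinnedChain ω₂ lam β γ).γ * OscillatorChain.bathWeight N i * v.2 i| ≤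
        2 * γ * ‖v‖ := by
      rw [hPγ, abs_mul, abs_mul, abs_of_nonneg hγ, abs_of_nonneg (bathWeight_nonneg N i)]
      exact mul_le_mul (((mul_le_mul_of_nonneg_left (bathWeight_le_two N i) hγ)).trans_eq
        (mul_comm _ _)) (hv2 i) (abs_nonneg _) (by positivity)
    calc |-(∑ j, (pinnedChain ω₂ lam β γ).hessPotential N i j x.1 * v.1 j) -
            (pinnedChain ω₂ lam β γ).γ * OscillatorChain.bathWeight N i * v.2 i|
        ≤ |∑ j, (pinnedChain ω₂ lam β γ).hessPotential N i j x.1 * v.1 j| +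
            |(pinnedChain ω₂ lam β γ).γ * OscillatorChain.bathWeight N i * v.2 i| := by
          rw [sub_eq_add_neg]
          refine (abs_add_le _ _).trans ?_
          rw [abs_neg, abs_neg]
      _ ≤ (N : ℝ) * (K * ‖v‖) + 2 * γ * ‖v‖ := add_le_add hs hb
      _ ≤ (driftA₀ ω₂ γ N + driftA₁ lam β N * √H) * ‖v‖ := by
          rw [hA]; nlinarith [norm_nonneg v]

end Drift

end Summit.AtomisticToContinuum.FouriersLaw.Theorems.ExtensiveSnapshotIrreversibility.EnergyWindow

end
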